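import Mathlib
import Literature.NumberTheory.EllipticCurves.DeligneSerreProp27LevelDescentProofs
import Literature.NumberTheory.EllipticCurves.NewformGaloisRepIntegralityProofs
import Literature.NumberTheory.EllipticCurves.ModularCurveSturmProofs

/-!
# Sup-norm Sturm bound along `ι : ℚ̄_p ≃ ℂ` for `S_W(Γ₁(N))` (stub `stub_supNormOfSturm`)

Crux item stmt-Langlands-8457, route `CapacityClassicality`, line `Sketch`, stub
`stub_supNormOfSturm`: from Sturm's congruence bound mod `p` over `ℤ` for `S_k(Γ₁(N))`
(hypothesis `hSturm`) and the integral span of `S_W(Γ₁(N))` (Deligne–Serre 1974, Prop. 2.7,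
PROVED in the tree: `DeligneSerre1974_span_integralLattice1_holds`), a cusp form
`G ∈ S_W(Γ₁(N))` whose first `⌊W μ/12⌋ + 1` Fourier coefficients (`μ = [SL₂(ℤ) : Γ₁(N)]`) are
`ι`-adically `≤ ε` has all its coefficients `ι`-adically `≤ ε`.

## Proof

Let `L ⊆ S_W(Γ₁(N))` be the `ℤ`-module of forms with integer `q`-expansion; it spans over `ℂ`
(Deligne–Serre) and is free of finite rank `δ` (the truncation `f ↦ (a_n(f))_{n ≤ B}`,
`B = ⌊W μ/12⌋`, is injective by the complex Sturm bound, so `L ↪ ℤ^{B+1}`).  For a `ℤ`-basis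
`f_1, …, f_δ` of `L` the integer matrix `A = (a_i(f_j))_{j, i ≤ B}` has linearly independent rows
mod `p`: a relation `∑ x_j a_i(f_j) ≡ 0 (p)` for all `i ≤ B` gives `f = ∑ x_j f_j ∈ L` with
`p ∣ a_n(f)` for `n ≤ B`, hence for all `n` (`hSturm`), so `f / p ∈ L` and `p ∣ x_j`.  Hence
`A` has a right inverse mod `p`, and by the adjugate trick an integer matrix `C` with
`A C = D · 1`, `p ∤ D`.  Writing `G = ∑ x_j f_j` (`x_j ∈ ℂ`) one gets the universal identity
`D · a_m(G) = ∑_{i ≤ B} k_i a_i(G)` with integers `k_i`; applying `ι⁻¹` and the ultrametric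
inequality (`‖ι⁻¹ D‖ = 1`, `‖ι⁻¹ k_i‖ ≤ 1`) gives `‖ι⁻¹ a_m(G)‖ ≤ ε`.
-/

open scoped MatrixGroups Manifold Topology Matrix
open UpperHalfPlane CongruenceSubgroup Metric PowerSeries
open Literature.NumberTheory.Automorphic
open Literature.NumberTheory.EllipticCurves Literature.NumberTheory.EllipticCurves.ModularForms

set_option linter.dupNamespace false -- project-wide option (lakefile weak.linter.dupNamespace); `Summit.Langlands.Langlands` is the mandated namespace

noncomputable section

namespace Summit.Langlands.Langlands.Theorems.CapacityClassicality

/-! ### Lattice algebra in an abstract `ℂ`-vector space with coefficient functionals -/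

/-- A `ℂ`-linear functional taking integer values on a `ℤ`-submodule `L` restricts to a
`ℤ`-linear functional `L → ℤ`. -/
private theorem exists_intFunctional {V : Type*} [AddCommGroup V] [Module ℂ V] (c : V →ₗ[ℂ] ℂ)
    (L : Submodule ℤ V) (h : ∀ f ∈ L, ∃ z : ℤ, (z : ℂ) = c f) :
    ∃ g : L →ₗ[ℤ] ℤ, ∀ f : L, (g f : ℂ) = c f := by
  choose z hz using h
  refine ⟨(AddMonoidHom.mk' (fun f : L ↦ z f f.2) fun f g ↦ ?_).toIntLinearMap, fun f ↦ hz f f.2⟩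
  apply Int.cast_injective (α := ℂ)
  push_cast
  rw [hz, hz, hz, map_add]

/-- If finitely many of the functionals `c 0, …, c B` already separate points of `V`, the
`ℤ`-module `L` of vectors on which all `c n` are integral is finitely generated (it embeds into
`ℤ^{B+1}`). -/
private theorem lattice_finite {V : Type*} [AddCommGroup V] [Module ℂ V] (c : ℕ → V →ₗ[ℂ] ℂ)
    (B : ℕ) (hinj : ∀ f : V, (∀ n ≤ B, c n f = 0) → f = 0)
    (L : Submodule ℤ V) (hL : ∀ f ∈ L, ∀ n, ∃ z : ℤ, (z : ℂ) = c n f) : Module.Finite ℤ L := by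
  rw [Module.Finite.iff_fg]
  let Φ : V →ₗ[ℂ] (Fin (B + 1) → ℂ) := LinearMap.pi fun i ↦ c i
  have hΦ : Function.Injective Φ := by
    rw [injective_iff_map_eq_zero]
    intro f hf
    exact hinj f fun n hn ↦ congr_fun hf ⟨n, Nat.lt_succ_of_le hn⟩
  let T : (Fin (B + 1) → ℤ) →ₗ[ℤ] (Fin (B + 1) → ℂ) :=
    (Algebra.linearMap ℤ ℂ).compLeft (Fin (B + 1))
  have hle : L.map (Φ.restrictScalars ℤ) ≤ LinearMap.range T := by
    rintro _ ⟨f, hf, rfl⟩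
    choose z hz using hL f hf
    refine ⟨fun j ↦ z j, ?_⟩
    funext j
    simp [T, Φ, hz]
  have hfgT : (L.map (Φ.restrictScalars ℤ)).FG := by
    rw [← Submodule.map_comap_eq_self hle]
    exact (IsNoetherian.noetherian _).map T
  exact Submodule.fg_of_fg_map_injective (Φ.restrictScalars ℤ) (fun a b h ↦ hΦ h) hfgT

/-- **Adjugate trick.** An integer matrix `A` whose rows are linearly independent mod `p` admits
an integer matrix `C` with `A C = D · 1` and `p ∤ D`: lift a right inverse of `A mod p` to an
integer matrix `C₀`, so that `A C₀ ≡ 1 (p)`, and put `C = C₀ adj(A C₀)`, `D = det(A C₀)`. -/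
private theorem exists_mul_eq_smul_one {δ ν : ℕ} (p : ℕ) [Fact p.Prime]
    (A : Matrix (Fin δ) (Fin ν) ℤ)
    (hA : ∀ x : Fin δ → ℤ, (∀ i, (p : ℤ) ∣ (x ᵥ* A) i) → ∀ j, (p : ℤ) ∣ x j) :
    ∃ (D : ℤ) (C : Matrix (Fin ν) (Fin δ) ℤ),
      ¬ (p : ℤ) ∣ D ∧ A * C = D • (1 : Matrix (Fin δ) (Fin δ) ℤ) := by
  obtain ⟨Ab, hAb⟩ :
      ∃ Ab : Matrix (Fin δ) (Fin ν) (ZMod p), Ab = A.map (Int.castRingHom (ZMod p)) := ⟨_, rfl⟩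
  -- the rows of `A mod p` are linearly independent: `v ↦ Abᵀ v` is injective
  have hker : LinearMap.ker (Matrix.toLin' Abᵀ) = ⊥ := by
    rw [LinearMap.ker_eq_bot']
    intro v hv
    rw [Matrix.toLin'_apply, Matrix.mulVec_transpose] at hv
    have hv' : ∀ i, (p : ℤ) ∣ ((fun j ↦ ((v j).val : ℤ)) ᵥ* A) i := by
      intro i
      rw [← ZMod.intCast_zmod_eq_zero_iff_dvd]
      have h := congr_fun hv i
      simp only [Matrix.vecMul, dotProduct, Pi.zero_apply, hAb, Matrix.map_apply, eq_intCast]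
        at h ⊢
      push_cast
      simpa only [ZMod.natCast_zmod_val] using h
    funext j
    have hj := hA _ hv' j
    rw [← ZMod.intCast_zmod_eq_zero_iff_dvd] at hj
    simpa only [Int.cast_natCast, ZMod.natCast_zmod_val, Pi.zero_apply] using hj
  -- a right inverse mod `p`
  obtain ⟨g, hg⟩ := LinearMap.exists_leftInverse_of_injective _ hker
  have hC : Ab * (LinearMap.toMatrix' g)ᵀ = 1 := by
    have h := congrArg LinearMap.toMatrix' hg
    rw [LinearMap.toMatrix'_comp, LinearMap.toMatrix'_toLin', LinearMap.toMatrix'_id] at h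
    simpa only [Matrix.transpose_mul, Matrix.transpose_transpose, Matrix.transpose_one] using
      congrArg Matrix.transpose h
  -- an integer lift `C₀` of it
  obtain ⟨C₀, hC₀⟩ : ∃ C₀ : Matrix (Fin ν) (Fin δ) ℤ,
      C₀.map (Int.castRingHom (ZMod p)) = (LinearMap.toMatrix' g)ᵀ := by
    refine ⟨(LinearMap.toMatrix' g)ᵀ.map fun a ↦ (a.val : ℤ), ?_⟩
    ext i j
    simp
  have hdet : (((A * C₀).det : ℤ) : ZMod p) = 1 := by
    have h := RingHom.map_det (Int.castRingHom (ZMod p)) (A * C₀)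
    rw [eq_intCast, RingHom.mapMatrix_apply, Matrix.map_mul, hC₀, ← hAb, hC, Matrix.det_one] at h
    exact h
  refine ⟨(A * C₀).det, C₀ * (A * C₀).adjugate, fun hdvd ↦ ?_, ?_⟩
  · rw [← ZMod.intCast_zmod_eq_zero_iff_dvd, hdet] at hdvd
    exact one_ne_zero hdvd
  · rw [← Matrix.mul_assoc, Matrix.mul_adjugate]

/-- **The integral structure.** Let `c n` (`n : ℕ`) be linear functionals on a `ℂ`-vector
space `V` such that `c 0, …, c B` separate points, the `ℤ`-module `L` of `c`-integral vectors
spans `V`, and Sturm's bound mod `p` holds on `L` (if `p ∣ c n f` for `n ≤ B` then for all `n`).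
Then for every `m` there are an integer `D` prime to `p` and integers `k_0, …, k_B` with
`D · c m = ∑ k_i · c i` on `V`. -/
private theorem exists_int_combination {V : Type*} [AddCommGroup V] [Module ℂ V]
    (c : ℕ → V →ₗ[ℂ] ℂ) (B : ℕ) (p : ℕ) [Fact p.Prime]
    (hinj : ∀ f : V, (∀ n ≤ B, c n f = 0) → f = 0)
    (L : Submodule ℤ V) (hL : ∀ f, f ∈ L ↔ ∀ n, ∃ z : ℤ, (z : ℂ) = c n f)
    (hspan : Submodule.span ℂ (L : Set V) = ⊤)
    (hSturm : ∀ (f : V) (z : ℕ → ℤ), (∀ n, c n f = z n) →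
      (∀ n ≤ B, (p : ℤ) ∣ z n) → ∀ n, (p : ℤ) ∣ z n)
    (m : ℕ) :
    ∃ D : ℤ, ¬ (p : ℤ) ∣ D ∧ ∃ k : Fin (B + 1) → ℤ,
      ∀ G : V, (D : ℂ) * c m G = ∑ i, (k i : ℂ) * c i G := by
  classical
  -- `L` is free of finite rank: pick a `ℤ`-basis `b`
  haveI : IsAddTorsionFree V := IsAddTorsionFree.of_isTorsionFree ℂ V
  haveI : Module.Finite ℤ L := lattice_finite c B hinj L fun f hf ↦ (hL f).mp hf
  obtain ⟨δ, b⟩ := Module.basisOfFiniteTypeTorsionFree' (R := ℤ) (M := L)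
  -- the integer coefficient functionals on `L`
  have hcL : ∀ n, ∃ g : L →ₗ[ℤ] ℤ, ∀ f : L, (g f : ℂ) = c n f := fun n ↦
    exists_intFunctional (c n) L fun f hf ↦ (hL f).mp hf n
  choose cL hcL using hcL
  -- the truncated coefficient matrix of the basis
  obtain ⟨A, hA⟩ : ∃ A : Matrix (Fin δ) (Fin (B + 1)) ℤ, ∀ j i, A j i = cL i (b j) :=
    ⟨Matrix.of fun j i ↦ cL i (b j), fun j i ↦ rfl⟩
  have hp0 : (p : ℂ) ≠ 0 := Nat.cast_ne_zero.mpr (Fact.out : p.Prime).ne_zero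
  -- Step 1: the rows of `A` are linearly independent mod `p`
  have hindep : ∀ x : Fin δ → ℤ, (∀ i, (p : ℤ) ∣ (x ᵥ* A) i) → ∀ j, (p : ℤ) ∣ x j := by
    intro x hx
    obtain ⟨f, hf⟩ : ∃ f : L, f = ∑ j, x j • b j := ⟨_, rfl⟩
    have hrepr : ∀ j, b.repr f j = x j := fun j ↦ by
      rw [hf]
      exact congr_fun (b.repr_sum_self x) j
    have hcf : ∀ n, cL n f = ∑ j, x j * cL n (b j) := by
      intro n
      simp [hf, map_sum]
    have hdvdB : ∀ n ≤ B, (p : ℤ) ∣ cL n f := by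
      intro n hn
      have h := hx ⟨n, Nat.lt_succ_of_le hn⟩
      have h' : (x ᵥ* A) ⟨n, Nat.lt_succ_of_le hn⟩ = cL n f := by
        simp [Matrix.vecMul, dotProduct, hA, hcf]
      rwa [h'] at h
    have hdvd : ∀ n, (p : ℤ) ∣ cL n f :=
      hSturm (f : V) (fun n ↦ cL n f) (fun n ↦ (hcL n f).symm) hdvdB
    choose w hw using hdvd
    -- `f / p ∈ L`
    have hf' : (p : ℂ)⁻¹ • (f : V) ∈ L := by
      rw [hL]
      intro n
      refine ⟨w n, ?_⟩
      rw [map_smul, smul_eq_mul, ← hcL n f, hw n]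
      push_cast
      rw [← mul_assoc, inv_mul_cancel₀ hp0, one_mul]
    obtain ⟨y, hy⟩ : ∃ y : L, (p : ℤ) • y = f := by
      refine ⟨⟨_, hf'⟩, Subtype.ext ?_⟩
      rw [Submodule.coe_smul, ← Int.cast_smul_eq_zsmul ℂ, Int.cast_natCast, smul_smul,
        mul_inv_cancel₀ hp0, one_smul]
    intro j
    refine ⟨b.repr y j, ?_⟩
    rw [← hrepr j, ← hy, map_smul, Finsupp.smul_apply, smul_eq_mul]
  -- Step 2: the adjugate trick
  obtain ⟨D, C, hD, hAC⟩ := exists_mul_eq_smul_one p A hindep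
  refine ⟨D, hD, C *ᵥ fun j ↦ cL m (b j), fun G ↦ ?_⟩
  -- Step 3: `G` is a `ℂ`-combination of the basis
  have hG : G ∈ Submodule.span ℂ (Set.range fun j ↦ ((b j : L) : V)) := by
    have hle : Submodule.span ℂ (L : Set V) ≤
        Submodule.span ℂ (Set.range fun j ↦ ((b j : L) : V)) := by
      rw [Submodule.span_le]
      intro f hf
      have hsum := congrArg Subtype.val (b.sum_repr ⟨f, hf⟩)
      simp only [Submodule.coe_sum, Submodule.coe_smul_of_tower] at hsum
      rw [SetLike.mem_coe, ← hsum]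
      exact Submodule.sum_mem _ fun j _ ↦
        zsmul_mem (Submodule.subset_span (Set.mem_range_self j)) _
    exact hle (hspan ▸ Submodule.mem_top)
  obtain ⟨x, rfl⟩ := (Submodule.mem_span_range_iff_exists_fun ℂ).mp hG
  -- Step 4: the identity `D · c m G = ∑ k_i · c i G`
  have hcG : ∀ n, c n (∑ j, x j • ((b j : L) : V)) = ∑ j, x j * (cL n (b j) : ℂ) := by
    intro n
    rw [map_sum]
    simp only [map_smul, smul_eq_mul, hcL]
  obtain ⟨a, ha⟩ : ∃ a : Fin δ → ℂ, ∀ j, a j = (cL m (b j) : ℂ) := ⟨_, fun j ↦ rfl⟩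
  have hAC' : A.map (Int.castRingHom ℂ) * C.map (Int.castRingHom ℂ) =
      Matrix.diagonal fun _ ↦ (D : ℂ) := by
    rw [← Matrix.map_mul, hAC, Matrix.smul_one_eq_diagonal, Matrix.diagonal_map (map_zero _)]
    simp only [eq_intCast]
  have h1 : ∀ i : Fin (B + 1),
      c i (∑ j, x j • ((b j : L) : V)) = (x ᵥ* A.map (Int.castRingHom ℂ)) i := by
    intro i
    rw [hcG]
    simp [Matrix.vecMul, dotProduct, hA]
  have h2 : c m (∑ j, x j • ((b j : L) : V)) = x ⬝ᵥ a := by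
    rw [hcG]
    simp [dotProduct, ha]
  have h3 : ∀ i, (((C *ᵥ fun j ↦ cL m (b j)) i : ℤ) : ℂ) = (C.map (Int.castRingHom ℂ) *ᵥ a) i := by
    intro i
    simp [Matrix.mulVec, dotProduct, ha]
  calc (D : ℂ) * c m (∑ j, x j • ((b j : L) : V))
      = (x ᵥ* (A.map (Int.castRingHom ℂ) * C.map (Int.castRingHom ℂ))) ⬝ᵥ a := by
        rw [h2, hAC']
        simp only [dotProduct, Matrix.vecMul_diagonal, Finset.mul_sum]
        exact Finset.sum_congr rfl fun j _ ↦ by ring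
    _ = (x ᵥ* A.map (Int.castRingHom ℂ)) ⬝ᵥ (C.map (Int.castRingHom ℂ) *ᵥ a) := by
        rw [← Matrix.vecMul_vecMul, Matrix.dotProduct_mulVec]
    _ = ∑ i, (((C *ᵥ fun j ↦ cL m (b j)) i : ℤ) : ℂ) * c i (∑ j, x j • ((b j : L) : V)) := by
        rw [dotProduct]
        exact Finset.sum_congr rfl fun i _ ↦ by rw [h1, h3, mul_comm]

/-- **Ultrametric step.** If `D · t = ∑ k_i u_i` with `p ∤ D`, `k_i ∈ ℤ`, and all `‖φ u_i‖ ≤ ε`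
in `ℚ̄_p`, then `‖φ t‖ ≤ ε` (`‖D‖ = 1`, `‖k_i‖ ≤ 1`, strong triangle inequality). -/
private theorem norm_le_of_int_combination (p : ℕ) [Fact p.Prime] (φ : ℂ ≃+* PadicAlgCl p)
    {ν : ℕ} {D : ℤ} (hD : ¬ (p : ℤ) ∣ D) (k : Fin ν → ℤ) (u : Fin ν → ℂ) {t : ℂ}
    (ht : (D : ℂ) * t = ∑ i, (k i : ℂ) * u i) {ε : ℝ} (hε : 0 ≤ ε) (hu : ∀ i, ‖φ (u i)‖ ≤ ε) :
    ‖φ t‖ ≤ ε := by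
  have hD1 : ‖(D : PadicAlgCl p)‖ = 1 := by
    rw [← map_intCast (algebraMap ℚ_[p] (PadicAlgCl p)) D, ← PadicAlgCl.coe_eq]
    change ‖((D : ℚ_[p]) : PadicAlgCl p)‖ = 1
    rw [PadicAlgCl.norm_extends, Padic.norm_intCast_eq_one_iff]
    exact ((Nat.prime_iff_prime_int.mp Fact.out).coprime_iff_not_dvd.mpr hD).symm
  have hφ := congrArg φ ht
  rw [map_mul, map_intCast, map_sum] at hφ
  have hnorm : ‖φ t‖ = ‖(D : PadicAlgCl p) * φ t‖ := by rw [norm_mul, hD1, one_mul]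
  rw [hnorm, hφ]
  refine IsUltrametricDist.norm_sum_le_of_forall_le_of_nonneg hε fun i _ ↦ ?_
  rw [map_mul, map_intCast, norm_mul]
  calc ‖(k i : PadicAlgCl p)‖ * ‖φ (u i)‖ ≤ 1 * ε :=
        mul_le_mul (IsUltrametricDist.norm_intCast_le_one _ _) (hu i) (norm_nonneg _) zero_le_one
    _ = ε := one_mul ε

/-! ### The stub -/

/-- **Sup-norm Sturm bound along `ι` (integral structure of `S_W(Γ₁(N))`).** From Sturm's bound
mod `p` over `ℤ` (`hSturm`, the shape of `stub_sturmModPrime` at this `N, p`) and the fact, PROVED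
in the tree, that `S_W(Γ₁(N))` is spanned over `ℂ` by forms with integer q-expansions
(`DeligneSerre1974_span_integralLattice1_holds`): a cusp form `G ∈ S_W(Γ₁(N)) ⊗ ℂ` whose first
`⌊W·[SL₂(ℤ):Γ₁(N)]/12⌋ + 1` coefficients are `ι`-adically `≤ ε` has ALL coefficients `≤ ε` (the
truncation matrix of a `ℤ`-basis of the integral lattice has a maximal minor prime to `p`; invert it
by the adjugate). -/
theorem stub_supNormOfSturm (p : ℕ) [Fact p.Prime] (N : ℕ) [NeZero N]
    (hSturm : ∀ (k : ℤ) (f : CuspForm (CongruenceSubgroup.Gamma1 N) k) (z : ℕ → ℤ),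
      (∀ n : ℕ, coeff n (qExpansion 1 ⇑f) = (z n : ℂ)) →
      (∀ n : ℕ, n ≤ (k * ((CongruenceSubgroup.Gamma1 N).index : ℤ)).toNat / 12 → (p : ℤ) ∣ z n) →
      ∀ n : ℕ, (p : ℤ) ∣ z n)
    (ι : PadicAlgCl p ≃+* ℂ) (W : ℤ) (G : CuspForm (CongruenceSubgroup.Gamma1 N) W) (ε : ℝ)
    (hε : 0 ≤ ε)
    (hG : ∀ m : ℕ, m ≤ (W * ((CongruenceSubgroup.Gamma1 N).index : ℤ)).toNat / 12 →
      ‖ι.symm (coeff m (qExpansion 1 ⇑G))‖ ≤ ε) :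
    ∀ m : ℕ, ‖ι.symm (coeff m (qExpansion 1 ⇑G))‖ ≤ ε := by
  classical
  have h1 := HeckeTGamma1.one_mem_strictPeriods_Gamma1 N
  -- complex Sturm: the coefficients `a_0, …, a_B` separate `S_W(Γ₁(N))`
  have hinj : ∀ f : CuspForm (Gamma1 N) W,
      (∀ n ≤ (W * ((CongruenceSubgroup.Gamma1 N).index : ℤ)).toNat / 12,
        cuspCoeffₗ h1 n f = 0) → f = 0 := by
    intro f hf
    refine DFunLike.ext' ((coe_eq_zero_of_isBigO_exp' f
      (isBigO_exp_of_qExpansion_coeff_eq_zero f h1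
        (m := (W * ((CongruenceSubgroup.Gamma1 N).index : ℤ)).toNat / 12 + 1)
        fun i hi ↦ hf i (Nat.lt_succ_iff.mp hi)) ?_).trans CuspForm.coe_zero.symm)
    rw [card_quotient_subgroupOf_eq_index]
    exact_mod_cast Nat.lt_succ_self _
  by_cases hW : 1 ≤ W
  swap
  · -- `W ≤ 0`: `S_W(Γ₁(N)) = 0`
    have hB : (W * ((CongruenceSubgroup.Gamma1 N).index : ℤ)).toNat / 12 = 0 := by
      rw [Int.toNat_eq_zero.mpr (mul_nonpos_iff.mpr (Or.inr ⟨by omega, by positivity⟩)),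
        Nat.zero_div]
    have hG0 : G = 0 := hinj G fun n hn ↦ by
      obtain rfl : n = 0 := by omega
      exact CuspFormClass.qExpansion_coeff_zero G one_pos h1
    intro m
    change ‖ι.symm (cuspCoeffₗ h1 m G)‖ ≤ ε
    rw [hG0, map_zero, map_zero, norm_zero]
    exact hε
  · -- `W ≥ 1`: the lattice of forms with integer `q`-expansion spans (Deligne–Serre)
    obtain ⟨L, hLdef⟩ : ∃ L : Submodule ℤ (CuspForm (Gamma1 N) W), L = ⨅ n : ℕ,
        (LinearMap.range (Algebra.linearMap ℤ ℂ)).comap ((cuspCoeffₗ h1 n).restrictScalars ℤ) :=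
      ⟨_, rfl⟩
    have hL : ∀ f, f ∈ L ↔ ∀ n, ∃ z : ℤ, (z : ℂ) = cuspCoeff f n := by
      intro f
      simp [hLdef, Submodule.mem_iInf, LinearMap.mem_range]
    have hspan : Submodule.span ℂ (L : Set (CuspForm (Gamma1 N) W)) = ⊤ := by
      refine eq_top_iff.mpr ((DeligneSerre1974_span_integralLattice1_holds N W hW).symm.le.trans
        (Submodule.span_mono fun f hf ↦ ?_))
      exact (hL f).mpr fun n ↦ exists_int_eq_cuspCoeff_of_mem_integralLattice1 hf n
    intro m
    obtain ⟨D, hD, k, hk⟩ := exists_int_combination (fun n ↦ cuspCoeffₗ h1 n)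
      ((W * ((CongruenceSubgroup.Gamma1 N).index : ℤ)).toNat / 12) p hinj L hL hspan (hSturm W) m
    exact norm_le_of_int_combination p ι.symm hD k (fun i ↦ cuspCoeffₗ h1 i G) (hk G) hε
      fun i ↦ hG i (Nat.lt_succ_iff.mp i.isLt)

end Summit.Langlands.Langlands.Theorems.CapacityClassicality

end
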